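import Literature.Geometry.Kaehler.AnalyticSetSingularLocusCodim
import Literature.Geometry.Kaehler.AnalyticSetRegularUnion
import Literature.Geometry.Kaehler.IrreducibleComponentsDecompositionProofs

/-!
# The closure of `Z ∖ S` for analytic `Z, S`, and the dimension of its trace on `S`

Let `Z` and `S` be analytic subsets of a complex manifold `M`. This file proves, from the
(discharged) structure theory of `Literature/Geometry/Kaehler/AnalyticSet*.lean` and
`IrreducibleComponents*.lean`:

* `connectedComponentIn_regularLocus_subset_closure_diff` — a connected component `C` of `reg Z`
  through a point off `S` satisfies `C ⊆ cl (C ∖ S)` (identity principle along `C`,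
  [Chirka1989, §5.3]);
* `IsAnalyticSet.closure_diff_eq` — **`cl (Z ∖ S) = cl ⋃ {C : C a connected component of reg Z
  through a point of reg Z ∖ S}`**, hence (`IsAnalyticSet.isAnalyticSet_closure_diff`)
  **`cl (Z ∖ S)` is an analytic subset of `M`** [Chirka1989, §5.1 Thm. (2)] — the union of the
  irreducible components of `Z` not contained in `S`;
* `IsAnalyticSet.closure_diff_inter_eq_of_isCompact` — locally, `cl (Z ∖ S)` is the union of the
  closures of the FINITELY many such components meeting a given compact set
  [Chirka1989, §5.1 Thm. (1)];
* `IsAnalyticSet.succ_le_codim_closure_diff_inter` — **the trace of `cl (Z ∖ S)` on `S` has smaller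
  dimension**: if every regular point of `Z` off `S` has codimension `≥ c₀`, then every regular
  point of `cl (Z ∖ S) ∩ S` has codimension `≥ c₀ + 1` (each component `Y = cl C` is irreducible of
  pure codimension `≥ c₀` and `Y ⊄ S`, so `Y ∩ S` has no regular point of codimension `≤ codim Y`
  by the uniqueness theorem, `IsIrreducibleAnalyticSet.subset_of_isRegularPointOfCodim_inter`,
  [Chirka1989, §5.3 Cor. 1]; finite unions by `forall_regularLocus_biUnion_finset_le`).

This is the form of "a hypersurface section of a `(p+1)`-dimensional analytic set not containing
any of its components has dimension `≤ p`" used for the deformation to the tangent cone of an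
analytic set (`AnalyticSetDeformation.lean`, towards King's theorem
`Literature.Geometry.Kaehler.King1971_tangentCone`). Theorems only; no named facts.

## References

* E. M. Chirka, *Complex Analytic Sets*, Kluwer 1989, §5.1 Thm., §5.3 Cor. 1–2, §5.4
  [Chirka1989].
* H. Whitney, *Complex Analytic Varieties*, Addison-Wesley 1972, Ch. 2 §8–9 (closures of
  differences of varieties) [Whitney1972].
-/

open scoped Manifold Topology
open Set Filter Function

namespace Literature.Geometry.Kaehler

variable {E : Type*} [NormedAddCommGroup E] [NormedSpace ℂ E]
  {H : Type*} [TopologicalSpace H] {I : ModelWithCorners ℂ E H}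
  {M : Type*} [TopologicalSpace M] [ChartedSpace H M]
  [FiniteDimensional ℂ E] [IsManifold I 1 M] [I.Boundaryless]

/-! ### Components of `reg Z` through points off `S` -/

/-- **A connected component of `reg Z` through a point off the analytic set `S` is the closure of
its part off `S`**: otherwise `Z` lies in `S` near some point of the component, and the identity
principle along the component (`connectedComponentIn_regularLocus_subset_of_isAnalyticSet`)
forces the whole component into `S`. [cite: Chirka1989, §5.3 Prop. (proof)] -/
theorem connectedComponentIn_regularLocus_subset_closure_diff {Z S : Set M}
    (hS : IsAnalyticSet I S) {y : M} (hy : y ∈ regularLocus I Z) (hyS : y ∉ S) :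
    connectedComponentIn (regularLocus I Z) y ⊆
      closure (connectedComponentIn (regularLocus I Z) y \ S) := by
  intro z hz
  by_contra hzc
  rw [mem_closure_iff_nhds] at hzc
  push Not at hzc
  obtain ⟨N, hN, hNe⟩ := hzc
  have hzreg : z ∈ regularLocus I Z := connectedComponentIn_subset _ _ hz
  obtain ⟨N', hN'o, hzN', hN'N, hconn, hreg⟩ :=
    exists_nhds_preconnected_of_mem_regularLocus hzreg hN
  -- near `z`, `Z` lies in the component, hence in `S`
  have hZN' : Z ∩ N' ⊆ connectedComponentIn (regularLocus I Z) y := by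
    rw [connectedComponentIn_eq hz]
    exact hconn.subset_connectedComponentIn ⟨hzreg.1, hzN'⟩ hreg
  have hZS : Z ∩ N' ⊆ S := by
    intro w hw
    by_contra hwS
    have : w ∈ N ∩ (connectedComponentIn (regularLocus I Z) y \ S) := ⟨hN'N hw.2, hZN' hw, hwS⟩
    rw [hNe] at this
    exact this
  have hsub := connectedComponentIn_regularLocus_subset_of_isAnalyticSet (Z := Z) hS
    ⟨z, hz, N', hN'o.mem_nhds hzN', hZS⟩
  exact hyS (hsub (mem_connectedComponentIn hy))

/-- In particular such a component lies in `cl (Z ∖ S)`. [cite: Chirka1989, §5.3 Prop. (proof)] -/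
theorem connectedComponentIn_regularLocus_subset_closure_diff' {Z S : Set M}
    (hS : IsAnalyticSet I S) {y : M} (hy : y ∈ regularLocus I Z) (hyS : y ∉ S) :
    connectedComponentIn (regularLocus I Z) y ⊆ closure (Z \ S) :=
  (connectedComponentIn_regularLocus_subset_closure_diff hS hy hyS).trans
    (closure_mono (sdiff_subset_sdiff_left ((connectedComponentIn_subset _ _).trans
      (regularLocus_subset _))))

/-! ### `cl (Z ∖ S)` is the closure of the union of the components off `S` -/

/-- **`cl (Z ∖ S)` is the closure of the union of the connected components of `reg Z` through the
points of `reg Z ∖ S`.** One inclusion is the previous lemma; for the other, a point of `Z ∖ S` lies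
on the closure of some component ([Chirka1989, §5.4 Thm. (2)], discharged), which cannot lie in the
closed set `S`, hence passes through a regular point off `S`. [cite: Chirka1989, §5.4 Thm. (2)] -/
theorem IsAnalyticSet.closure_diff_eq {Z S : Set M} (hZ : IsAnalyticSet I Z) (hS : IsAnalyticSet I S) :
    closure (Z \ S) =
      closure (⋃ y ∈ regularLocus I Z \ S, connectedComponentIn (regularLocus I Z) y) := by
  apply Subset.antisymm
  · refine closure_minimal (fun x hx => ?_) isClosed_closure
    have hdec := IsAnalyticSet.eq_iUnion_closure_connectedComponentIn_holds I M hZ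
    have hx' : x ∈ ⋃ y ∈ regularLocus I Z, closure (connectedComponentIn (regularLocus I Z) y) := by
      rw [← hdec]; exact hx.1
    obtain ⟨y₀, hy₀, hxy₀⟩ := mem_iUnion₂.1 hx'
    -- the component of `y₀` is not contained in `S`
    have hnot : ¬ connectedComponentIn (regularLocus I Z) y₀ ⊆ S := fun h =>
      hx.2 (closure_minimal h hS.isClosed hxy₀)
    obtain ⟨y, hyC, hyS⟩ := not_subset.1 hnot
    have hyreg : y ∈ regularLocus I Z := connectedComponentIn_subset _ _ hyC
    have hCeq : connectedComponentIn (regularLocus I Z) y₀ =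
        connectedComponentIn (regularLocus I Z) y := connectedComponentIn_eq hyC
    refine closure_mono ?_ hxy₀
    rw [hCeq]
    exact subset_biUnion_of_mem (u := fun y => connectedComponentIn (regularLocus I Z) y)
      (show y ∈ regularLocus I Z \ S from ⟨hyreg, hyS⟩)
  · refine closure_minimal (iUnion₂_subset fun y hy => ?_) isClosed_closure
    exact connectedComponentIn_regularLocus_subset_closure_diff' hS hy.1 hy.2

/-- **`cl (Z ∖ S)` is an analytic subset** (the union of the irreducible components of `Z` not
contained in `S`). [cite: Chirka1989, §5.1 Thm. (2)] -/
theorem IsAnalyticSet.isAnalyticSet_closure_diff {Z S : Set M} (hZ : IsAnalyticSet I Z)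
    (hS : IsAnalyticSet I S) : IsAnalyticSet I (closure (Z \ S)) := by
  rw [hZ.closure_diff_eq hS]
  exact IsAnalyticSet.isAnalyticSet_closure_biUnion_connectedComponentIn_holds I M hZ sdiff_subset

/-! ### Local finiteness: near a compact set only finitely many components matter -/

/-- The components of `reg Z` through points of `reg Z ∖ S` which meet the compact set `K` form a
finite set (of subsets of `M`). [cite: Chirka1989, §5.1 Thm. (1)] -/
theorem IsAnalyticSet.finite_setOf_component_diff_inter {Z S : Set M} (hZ : IsAnalyticSet I Z)
    {K : Set M} (hK : IsCompact K) :
    {C : Set M | (∃ y ∈ regularLocus I Z \ S, C = connectedComponentIn (regularLocus I Z) y) ∧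
      (C ∩ K).Nonempty}.Finite := by
  refine (IsAnalyticSet.finite_connectedComponentIn_regularLocus_inter_compact_holds I M hZ hK).subset ?_
  rintro C ⟨⟨y, hy, rfl⟩, hCK⟩
  exact ⟨⟨y, hy.1, rfl⟩, hCK⟩

/-- **Local description of `cl (Z ∖ S)`.** On the interior of a compact set `K`, `cl (Z ∖ S)`
coincides with the (finite) union of the closures of those components of `reg Z` through points
of `reg Z ∖ S` which meet `K`. [cite: Chirka1989, §5.1 Thm. (1)–(2)] -/
theorem IsAnalyticSet.closure_diff_inter_eq_of_isCompact {Z S : Set M} (hZ : IsAnalyticSet I Z)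
    (hS : IsAnalyticSet I S) {K : Set M} (hK : IsCompact K) :
    closure (Z \ S) ∩ interior K =
      (⋃ C ∈ (hZ.finite_setOf_component_diff_inter (S := S) hK).toFinset, closure C) ∩ interior K := by
  set F := (hZ.finite_setOf_component_diff_inter (S := S) hK).toFinset with hF
  have hmem : ∀ C, C ∈ F ↔ (∃ y ∈ regularLocus I Z \ S,
      C = connectedComponentIn (regularLocus I Z) y) ∧ (C ∩ K).Nonempty := fun C =>
    Set.Finite.mem_toFinset _
  rw [hZ.closure_diff_eq hS]
  apply Subset.antisymm
  · -- split the union into the components meeting `K` and the others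
    rintro x ⟨hx, hxK⟩
    refine ⟨?_, hxK⟩
    have hsplit : (⋃ y ∈ regularLocus I Z \ S, connectedComponentIn (regularLocus I Z) y) ⊆
        (⋃ C ∈ F, C) ∪ ⋃ y ∈ {y ∈ regularLocus I Z \ S |
          ¬ (connectedComponentIn (regularLocus I Z) y ∩ K).Nonempty},
            connectedComponentIn (regularLocus I Z) y := by
      intro w hw
      obtain ⟨y, hy, hwy⟩ := mem_iUnion₂.1 hw
      by_cases hne : (connectedComponentIn (regularLocus I Z) y ∩ K).Nonempty
      · exact Or.inl (mem_biUnion ((hmem _).2 ⟨⟨y, hy, rfl⟩, hne⟩) hwy)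
      · exact Or.inr (mem_biUnion (show y ∈ {y ∈ regularLocus I Z \ S |
          ¬ (connectedComponentIn (regularLocus I Z) y ∩ K).Nonempty} from ⟨hy, hne⟩) hwy)
    have hx' := closure_mono hsplit hx
    rw [closure_union] at hx'
    rcases hx' with h | h
    · -- closure of a finite union
      have : closure (⋃ C ∈ F, C) = ⋃ C ∈ F, closure C := by
        simp
      rw [this] at h
      exact h
    · -- the other components do not meet `interior K`
      exfalso
      have hdisj : Disjoint (⋃ y ∈ {y ∈ regularLocus I Z \ S |
          ¬ (connectedComponentIn (regularLocus I Z) y ∩ K).Nonempty},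
            connectedComponentIn (regularLocus I Z) y) (interior K) := by
        refine disjoint_left.2 fun w hw hwK => ?_
        obtain ⟨y, hy, hwy⟩ := mem_iUnion₂.1 hw
        exact hy.2 ⟨w, hwy, interior_subset hwK⟩
      have := hdisj.closure_left isOpen_interior
      exact disjoint_left.1 this h hxK
  · rintro x ⟨hx, hxK⟩
    refine ⟨?_, hxK⟩
    obtain ⟨C, hC, hxC⟩ := mem_iUnion₂.1 hx
    obtain ⟨⟨y, hy, rfl⟩, -⟩ := (hmem C).1 hC
    exact closure_mono (subset_biUnion_of_mem
      (u := fun y => connectedComponentIn (regularLocus I Z) y) hy) hxC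

/-! ### The trace of `cl (Z ∖ S)` on `S` has smaller dimension -/

/-- **One component.** Let `C` be the component of `reg Z` through a regular point `y ∉ S` of
codimension `≥ c₀`. Then every regular point of `cl C ∩ S` has codimension `≥ c₀ + 1`: `cl C` is
irreducible ([Chirka1989, §5.4 Lemma]) of pure codimension equal to the codimension of `Z` at `y`
(near `y`, `cl C` and `Z` agree), and is not contained in `S`; so by the uniqueness theorem
(`IsIrreducibleAnalyticSet.subset_of_isRegularPointOfCodim_inter`, [Chirka1989, §5.3 Cor. 1])
`cl C ∩ S` has no regular point of codimension `≤ codim (cl C)`. [cite: Chirka1989, §5.3 Cor. 1] -/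
theorem succ_le_codim_closure_connectedComponentIn_inter {Z S : Set M} (hZ : IsAnalyticSet I Z)
    (hS : IsAnalyticSet I S) {c₀ : ℕ} {y : M} (hy : y ∈ regularLocus I Z) (hyS : y ∉ S)
    (hc₀ : ∀ c, IsRegularPointOfCodim I Z c y → c₀ ≤ c) {x : M} {c : ℕ}
    (hx : x ∈ closure (connectedComponentIn (regularLocus I Z) y) ∩ S)
    (hreg : IsRegularPointOfCodim I (closure (connectedComponentIn (regularLocus I Z) y) ∩ S) c x) :
    c₀ + 1 ≤ c := by
  set Y := closure (connectedComponentIn (regularLocus I Z) y) with hYdef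
  have hYirr : IsIrreducibleAnalyticSet I Y := hZ.isIrreducibleAnalyticSet_closure_connectedComponentIn hy
  obtain ⟨c₁, hYc₁⟩ := IsIrreducibleAnalyticSet.exists_hasPureCodim_holds I M hYirr
  -- `Y` agrees with `Z` near `y`, so `codim Y = codim_y Z ≥ c₀`
  obtain ⟨cy, hcy⟩ := hy.2
  obtain ⟨N, hNo, hyN, -, hconn, hNreg⟩ := exists_nhds_preconnected_of_mem_regularLocus hy univ_mem
  have hZN : Z ∩ N ⊆ connectedComponentIn (regularLocus I Z) y :=
    hconn.subset_connectedComponentIn ⟨hy.1, hyN⟩ hNreg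
  have hYZ : Y ∩ N = Z ∩ N := by
    apply Subset.antisymm
    · exact inter_subset_inter_left _ (closure_minimal
        ((connectedComponentIn_subset _ _).trans (regularLocus_subset _)) hZ.isClosed)
    · exact fun w hw => ⟨subset_closure (hZN hw), hw.2⟩
  have hyY : IsRegularPointOfCodim I Y cy y := hcy.congr_set hNo hyN hYZ.symm
  have hyYreg : y ∈ regularLocus I Y := ⟨subset_closure (mem_connectedComponentIn hy), cy, hyY⟩
  have hc₁cy : c₁ = cy := (hYc₁.2.2 y hyYreg).codim_unique hyYreg.1 hyY
  have hc₀c₁ : c₀ ≤ c₁ := hc₁cy ▸ hc₀ cy hcy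
  -- if `c ≤ c₁`, the uniqueness theorem gives `Y ⊆ S`, contradicting `y ∉ S`
  by_contra hlt
  have hcc₁ : c ≤ c₁ := by omega
  have hYS : Y ⊆ S := hYirr.subset_of_isRegularPointOfCodim_inter hS hYc₁ hx hreg hcc₁
  exact hyS (hYS (subset_closure (mem_connectedComponentIn hy)))

/-- **The trace of `cl (Z ∖ S)` on `S` has smaller dimension than `Z ∖ S`.** If every regular point
of the analytic set `Z` lying off the analytic set `S` has codimension `≥ c₀`, then every regular
point of `cl (Z ∖ S) ∩ S` has codimension `≥ c₀ + 1` ("`dim (cl (Z ∖ S) ∩ S) < dim (Z ∖ S)`":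
no irreducible component of `cl (Z ∖ S)` lies in `S`). Locally `cl (Z ∖ S)` is a finite union of
closures of components through points off `S` (`closure_diff_inter_eq_of_isCompact`), to each of
which the one-component statement applies; finite unions by
`forall_regularLocus_biUnion_finset_le`. [cite: Chirka1989, §5.3 Cor. 1] -/
theorem IsAnalyticSet.succ_le_codim_closure_diff_inter [LocallyCompactSpace M] {Z S : Set M}
    (hZ : IsAnalyticSet I Z) (hS : IsAnalyticSet I S) {c₀ : ℕ}
    (hc₀ : ∀ y ∈ regularLocus I Z, y ∉ S → ∀ c, IsRegularPointOfCodim I Z c y → c₀ ≤ c)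
    {x : M} {c : ℕ} (hx : x ∈ closure (Z \ S) ∩ S)
    (hreg : IsRegularPointOfCodim I (closure (Z \ S) ∩ S) c x) : c₀ + 1 ≤ c := by
  classical
  -- a compact neighbourhood of `x` and the finitely many components meeting it
  obtain ⟨K, hK, hxK⟩ := exists_compact_mem_nhds x
  have hxK' : x ∈ interior K := mem_interior_iff_mem_nhds.2 hxK
  set F := (hZ.finite_setOf_component_diff_inter (S := S) hK).toFinset with hF
  have hmem : ∀ C, C ∈ F ↔ (∃ y ∈ regularLocus I Z \ S,
      C = connectedComponentIn (regularLocus I Z) y) ∧ (C ∩ K).Nonempty := fun C =>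
    Set.Finite.mem_toFinset _
  have hloc := hZ.closure_diff_inter_eq_of_isCompact hS hK
  -- transfer the regularity of `x` to the finite union
  set D := ⋃ C ∈ F, (closure C ∩ S) with hD
  have hDeq : (⋃ C ∈ F, closure C) ∩ S = D := by
    rw [hD, iUnion₂_inter]
  have htrace : (closure (Z \ S) ∩ S) ∩ interior K = D ∩ interior K := by
    rw [← hDeq, inter_right_comm, hloc, inter_right_comm]
  have hxD : x ∈ D := by
    have : x ∈ D ∩ interior K := htrace ▸ ⟨hx, hxK'⟩
    exact this.1
  have hregD : IsRegularPointOfCodim I D c x := hreg.congr_set isOpen_interior hxK' htrace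
  -- each piece is analytic with the codimension bound
  have hpieceA : ∀ C ∈ F, IsAnalyticSet I (closure C ∩ S) := by
    intro C hC
    obtain ⟨⟨y, hy, rfl⟩, -⟩ := (hmem C).1 hC
    exact (hZ.isIrreducibleAnalyticSet_closure_connectedComponentIn hy.1).1.inter hS
  have hpiece : ∀ C ∈ F, ∀ w ∈ regularLocus I (closure C ∩ S), ∀ q : ℕ,
      IsRegularPointOfCodim I (closure C ∩ S) q w → c₀ + 1 ≤ q := by
    intro C hC w hw q hq
    obtain ⟨⟨y, hy, rfl⟩, -⟩ := (hmem C).1 hC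
    exact succ_le_codim_closure_connectedComponentIn_inter hZ hS hy.1 hy.2
      (hc₀ y hy.1 hy.2) hw.1 hq
  exact forall_regularLocus_biUnion_finset_le F hpieceA hpiece x ⟨hxD, c, hregD⟩ c hregD

end Literature.Geometry.Kaehler
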